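import Summits.QuantumFields.YangMills.Theorems.BalabanUVNodesN06SectBQLawsKnit

/-!
# Balaban UV-stability nodes, N06 [B9] Sect. B — «K2-G-L2»: the K2-G size laws `hQ15` (block-sup) and `hQL2` (block-`ℓ²`) INHABITED AT THE KNIT PAIR for a
# member family, from the knit kernel data (`…N06SectBQLawsKnit`) + the regime bridge `(3.35) coded class ⟹ (3.35) local class` + the x-free numerics

[B9] = T. Bałaban, *Propagators for lattice gauge theories in a background field*, Commun. Math. Phys. **99** (1985) 389–434 [`Balaban1985BackgroundPropagators`];
[4] = [`Balaban1984PropagatorsII`]; [B8] = [`Balaban1985Averaging`].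

statement-level skeleton of published theorems with citation tags; proofs where landed; nothing here is a claim about the Yang–Mills mass gap

WHAT (seat dag-n06-c gen 25).  For a subfamily `f : J → MemberY`, `𝔸 = M_N(ℂ)`, `G ≤ U(N)`, a pair `(𝔮 j, 𝔮s j)` that IS the knit pair (`h𝔮 : 𝔮 j U = QknitY _ U`,
`h𝔮s : 𝔮s j U = adjTrY (QknitY _ U)` — def-Y's `qKnitOfRecord ∕ qsKnitOfRecord` faces supply these), β-sections `ιB j`, a regime bridge `hRP` from the frames' coded
class `(bg9YC M_N(ℂ) G P (f j)).Reg335 c35` to the local class `(bg9KP M_N(ℂ) G (f j).toKIdx).Reg335 c₀` (`c₀ ≦ 10`) and dag-n06-d's x-free knit numerics in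
dag-n06-l's shape (`hα' hαQ`, `hKpl : a ≦ aInv ⟹ K_pl(a)·L⁴ < α₀′`), any positive threshold `MInv`: ★★ `hQ15_knit` = the binder `hQ15` of
`B9SectBGFramesSelQY.gFrame₅CodedOnSelQ ∕ …` VERBATIM with `κQ := (M₂Σ‖b_j‖)·C_knit·e^{ℓ+4}`; ★★ `hQL2_knit` = the binder `hQL2` of `B9SectBL2GFrameSelQY.l2GFrame₈CodedOnSelQ`
VERBATIM with `κQ2 := (√|ι|·M₂Σ‖b_j‖)·√(C_knit·C_knit)·e^{ℓ+4}` — by `B9SectBQLawsL2OfKernelY.hQ15_of_kernels' ∕ hQL2_of_kernels` fed `knit_kernel_data_of_reg335P`.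

HONEST SCOPE.  Bookkeeping; the regime bridge and the numerics are HYPOTHESES (KC's standing ones); count-neutral; N06 NOT discharged; K1⁹ NOT closed; nothing
continuum ∕ OS ∕ mass-gap ∕ Clay.  0 `def`, 0 `sorry`.  `--supports stmt-QuantumFields-27364 --as helper`.
-/

noncomputable section

namespace Summit.QuantumFields.YangMills.BalabanUVNodes.N06SectBQLawsKnitMembers

open scoped Matrix Matrix.Norms.L2Operator
open Literature.MathematicalPhysics.QuantumFieldTheory.Balaban1983to89
open Literature.MathematicalPhysics.QuantumFieldTheory.Balaban1983to89.Node00 (SiteY BlkY FBondY IBondY CfgY repBondY)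
open Literature.MathematicalPhysics.QuantumFieldTheory.Balaban1983to89.Node00.OpsYQLetter (adjTrY)
open Literature.MathematicalPhysics.QuantumFieldTheory.Balaban1983to89.B6Ineq2142KLevelV1 (β qwt)
open Literature.MathematicalPhysics.QuantumFieldTheory.Balaban1983to89.B6GlobalChartV1 (blkV1 boxEquiv)
open Literature.MathematicalPhysics.QuantumFieldTheory.Balaban1983to89.B6KLevelCensusIndexV1 (KIdx kGeo)
open Literature.MathematicalPhysics.QuantumFieldTheory.Balaban1983to89.B6RandomWalk (HasMajorant)
open Literature.MathematicalPhysics.QuantumFieldTheory.Balaban1983to89.B6RandomWalkL2 (HasL2Majorant)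
open Literature.MathematicalPhysics.QuantumFieldTheory.Balaban1983to89.B9Thm34Ext (toB6)
open Literature.MathematicalPhysics.QuantumFieldTheory.Balaban1983to89.B9GeoNormsKLevelV1 (geo9K)
open Literature.MathematicalPhysics.QuantumFieldTheory.Balaban1983to89.B9PinMembersKLevelV1 (MemberY geo9Y)
open Literature.MathematicalPhysics.QuantumFieldTheory.Balaban1983to89.B9BackgroundsKLevelV1P (bg9KP)
open Literature.MathematicalPhysics.QuantumFieldTheory.Balaban1983to89.B9SectBCodedClassR (RegExtraY bg9YC)
open Literature.MathematicalPhysics.QuantumFieldTheory.Balaban1983to89.B9SectBGpLettersY (blkC)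
open Literature.MathematicalPhysics.QuantumFieldTheory.Balaban1983to89.B9SectBGWordDeltaAY (volY)
open Literature.MathematicalPhysics.QuantumFieldTheory.Balaban1983to89.B9SectBGWordDeltaAQY (QbQC QsbQC)
open Literature.MathematicalPhysics.QuantumFieldTheory.Balaban1983to89.B9SectBQLettersL2QY (QbQC2 QsbQC2)
open Literature.MathematicalPhysics.QuantumFieldTheory.Balaban1983to89.B9SectBL2GReadY (indB)
open Literature.MathematicalPhysics.QuantumFieldTheory.Balaban1983to89.B9SectBQLawsL2OfKernelY (hQ15_of_kernels' hQL2_of_kernels)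
open Literature.MathematicalPhysics.QuantumFieldTheory.Balaban1983to89.B7Prop2Explicit (unitaryUnits)
open Literature.MathematicalPhysics.QuantumFieldTheory.Balaban1983to89.B9Eq316AveragingTransposeZd (alphaQ)
open Literature.MathematicalPhysics.QuantumFieldTheory.Balaban1983to89.B9Eq3115KnitLetterY (QknitY)
open Literature.MathematicalPhysics.QuantumFieldTheory.Balaban1983to89.B9Eq3115KnitLetterYRowCloseness (boxK)
open Literature.MathematicalPhysics.QuantumFieldTheory.Balaban1983to89.B9C2FormBoxRegimeY (Kpl)
open Literature.MathematicalPhysics.QuantumFieldTheory.Balaban1983to89.B9Eq3115KnitLetterYOnto (kCol kCol_nonneg)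
open Summit.QuantumFields.YangMills.BalabanUVNodes.N06SectBQLawsKnit (knit_kernel_data_of_reg335P)

variable {d ℓ : ℕ} {hd : 1 ≤ d + 1} {hL : Odd (ℓ + 1) ∧ 1 < ℓ + 1} {b₀ b₁ : ℝ}
variable {N : ℕ} [Nonempty (Fin N)] {ι : Type} [Fintype ι]
variable {Mstar : ℕ} (P : RegExtraY d ℓ hd hL b₀ b₁ Mstar (Matrix (Fin N) (Fin N) ℂ)) {J : Type} (f : J → MemberY d ℓ hd hL b₀ b₁ Mstar)
  [∀ x : MemberY d ℓ hd hL b₀ b₁ Mstar, Fintype (geo9Y x).Site]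
  (c35 : ℝ) (G : Subgroup (Matrix (Fin N) (Fin N) ℂ)ˣ)
  (𝔮 : ∀ j : J, CfgY (Matrix (Fin N) (Fin N) ℂ) (f j).toKIdx → ((FBondY (f j).toKIdx → Matrix (Fin N) (Fin N) ℂ) →ₗ[ℂ] (IBondY (f j).toKIdx → Matrix (Fin N) (Fin N) ℂ)))
  (𝔮s : ∀ j : J, CfgY (Matrix (Fin N) (Fin N) ℂ) (f j).toKIdx → ((IBondY (f j).toKIdx → Matrix (Fin N) (Fin N) ℂ) →ₗ[ℂ] (FBondY (f j).toKIdx → Matrix (Fin N) (Fin N) ℂ)))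
  (b : Module.Basis ι ℝ (Matrix (Fin N) (Fin N) ℂ)) (ιB : ∀ j : J, BlkY (f j).toKIdx → IBondY (f j).toKIdx)

/-- ★★ **`hQ15` AT THE KNIT PAIR**: the block-sup size law of the K2-G frames, inhabited for the knit pair of a member family from the kernel data on (3.35), the
regime bridge and the x-free numerics; `κQ := (M₂Σ‖b_j‖)·C_knit·e^{ℓ+4}`, `C_knit = N⁴·(1 + 2(d+1))·(1 + K_col α₀′·2(d+1))`.
[cite: Balaban1985BackgroundPropagators, (3.12)–(3.15) pp.392–393, (3.35) p.396; Balaban1985Averaging, Prop. 2 p.26, (139)–(147) pp.39–40; Balaban1984PropagatorsII, (2.45)–(2.46) p.231, (2.51) p.232] -/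
theorem hQ15_knit (hGU : G ≤ unitaryUnits (Matrix (Fin N) (Fin N) ℂ))
    (hι : ∀ (j : J) (s : BlkY (f j).toKIdx), β (f j).hN (f j).D (f j).hk (ιB j s) = s) {M₂ : ℝ} (hM₂ : 0 ≤ M₂)
    (hrepr : ∀ (v : Matrix (Fin N) (Fin N) ℂ) (j : ι), |b.repr v j| ≤ M₂ * ‖v‖)
    (h𝔮 : ∀ (j : J) (U : CfgY (Matrix (Fin N) (Fin N) ℂ) (f j).toKIdx), 𝔮 j U = QknitY (f j).toKIdx U)
    (h𝔮s : ∀ (j : J) (U : CfgY (Matrix (Fin N) (Fin N) ℂ) (f j).toKIdx), 𝔮s j U = adjTrY (QknitY (f j).toKIdx U))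
    {MInv aInv : ℝ} (hMInv : 0 < MInv) {c₀ : ℝ} (hc : c₀ ≤ 10)
    (hRP : ∀ (j : J) (α₀ : ℝ) (U : CfgY (Matrix (Fin N) (Fin N) ℂ) (f j).toKIdx),
      (bg9YC (Matrix (Fin N) (Fin N) ℂ) G P (f j)).Reg335 c35 α₀ U → (bg9KP (Matrix (Fin N) (Fin N) ℂ) G (f j).toKIdx).Reg335 c₀ α₀ U)
    {α₀' : ℝ} (hα' : 0 < α₀') (hαQ : α₀' ≤ alphaQ (d + 1) (ℓ + 1))
    (hKpl : ∀ (j : J) (a : ℝ), 0 ≤ a → a ≤ aInv → Kpl (f j).toKIdx a * (kGeo (f j).toKIdx).L ^ 4 < α₀') :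
    ∀ j (α₀ : ℝ) (U : CfgY (Matrix (Fin N) (Fin N) ℂ) (f j).toKIdx) (δ : ℝ), MInv ≤ (geo9Y (f j)).M → 0 < α₀ → (geo9Y (f j)).M * α₀ ≤ aInv →
      (bg9YC (Matrix (Fin N) (Fin N) ℂ) G P (f j)).Reg335 c35 α₀ U → 0 < δ → δ ≤ 1 →
      HasMajorant (g := toB6 (geo9Y (f j)) 0 True) (fun q : (Fin (d + 1) × SiteY (f j).toKIdx) × ι => blkC (f j).toKIdx (ιB j) q.1.2)
          (QbQC (f j).toKIdx (𝔮 j) b (.base U))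
          (fun a a' => ((M₂ * ∑ j, ‖b j‖) * ((N : ℝ) ^ 4 * ((1 + 2 * ((d : ℝ) + 1)) * (1 + kCol (d + 1) (ℓ + 1) * α₀' * (2 * ((d : ℝ) + 1)))) *
            Real.exp ((ℓ : ℝ) + 4))) * Real.exp (-(δ * (geo9Y (f j)).dist a a'))) ∧
        HasMajorant (g := toB6 (geo9Y (f j)) 0 True) (fun q : (Fin (d + 1) × SiteY (f j).toKIdx) × ι => blkC (f j).toKIdx (ιB j) q.1.2)
          (QsbQC (f j).toKIdx (𝔮s j) b (.base U))
          (fun a a' => ((M₂ * ∑ j, ‖b j‖) * ((N : ℝ) ^ 4 * ((1 + 2 * ((d : ℝ) + 1)) * (1 + kCol (d + 1) (ℓ + 1) * α₀' * (2 * ((d : ℝ) + 1)))) *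
            Real.exp ((ℓ : ℝ) + 4))) * Real.exp (-(δ * (geo9Y (f j)).dist a a'))) := by
  refine hQ15_of_kernels' (Mstar := Mstar) b P f c35 G 𝔮 𝔮s ιB hM₂ hrepr MInv aInv (C := (N : ℝ) ^ 4 * ((1 + 2 * ((d : ℝ) + 1)) *
    (1 + kCol (d + 1) (ℓ + 1) * α₀' * (2 * ((d : ℝ) + 1))))) (r := (ℓ : ℝ) + 4)
    (mul_nonneg (pow_nonneg (Nat.cast_nonneg _) 4) (mul_nonneg (by positivity)
      (add_nonneg zero_le_one (mul_nonneg (mul_nonneg (kCol_nonneg _ _) hα'.le) (by positivity))))) (by positivity)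
    (fun j _ κ f' => qwt (f j).hN (f j).D (f j).hk κ f' + kCol (d + 1) (ℓ + 1) * α₀' * boxK (f j).toKIdx κ f')
    (fun j _ κ f' => (N : ℝ) ^ 4 * (qwt (f j).hN (f j).D (f j).hk κ f' + kCol (d + 1) (ℓ + 1) * α₀' * boxK (f j).toKIdx κ f'))
    fun j α₀ U hM hα₀ hMa hU => ?_
  have hMx : 0 ≤ (geo9Y (f j)).M := hMInv.le.trans hM
  have hMα : 0 ≤ (kGeo (f j).toKIdx).M * α₀ := mul_nonneg hMx hα₀.le
  have hK : Kpl (f j).toKIdx ((kGeo (f j).toKIdx).M * α₀) * (kGeo (f j).toKIdx).L ^ 4 < α₀' := hKpl j _ hMα hMa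
  obtain ⟨h1, h2, h3, h4, h5, h6, h7, h8, h9, h10⟩ :=
    knit_kernel_data_of_reg335P (f j).toKIdx (ιB j) hGU (hι j) hc hMα (hRP j α₀ U hU) hα' hαQ hK
  refine ⟨h1, fun Λ κ => ?_, h3, fun κ f' h => h5 κ f' h, h6, fun Ψ f' => ?_, h9, h10⟩
  · rw [h𝔮 j U]; exact h2 Λ κ
  · rw [h𝔮s j U]; exact h7 Ψ f'

/-- ★★ **`hQL2` AT THE KNIT PAIR**: the block-`ℓ²` size law of the K2-G `L²` frame, inhabited likewise; `κQ2 := (√|ι|·M₂Σ‖b_j‖)·√(C_knit·C_knit)·e^{ℓ+4}`.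
[cite: Balaban1985BackgroundPropagators, (3.15) p.393, (3.35) p.396, (3.46) p.398; Balaban1985Averaging, Prop. 2 p.26; Balaban1984PropagatorsII, Prop. 2.6 (2.140) p.247, (2.51) p.232] -/
theorem hQL2_knit [instDS : ∀ x : MemberY d ℓ hd hL b₀ b₁ Mstar, DecidableEq (geo9Y x).Site] (hGU : G ≤ unitaryUnits (Matrix (Fin N) (Fin N) ℂ))
    (hι : ∀ (j : J) (s : BlkY (f j).toKIdx), β (f j).hN (f j).D (f j).hk (ιB j s) = s) {M₂ : ℝ} (hM₂ : 0 ≤ M₂)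
    (hrepr : ∀ (v : Matrix (Fin N) (Fin N) ℂ) (j : ι), |b.repr v j| ≤ M₂ * ‖v‖)
    (h𝔮 : ∀ (j : J) (U : CfgY (Matrix (Fin N) (Fin N) ℂ) (f j).toKIdx), 𝔮 j U = QknitY (f j).toKIdx U)
    (h𝔮s : ∀ (j : J) (U : CfgY (Matrix (Fin N) (Fin N) ℂ) (f j).toKIdx), 𝔮s j U = adjTrY (QknitY (f j).toKIdx U))
    {MInv aInv : ℝ} (hMInv : 0 < MInv) {c₀ : ℝ} (hc : c₀ ≤ 10)
    (hRP : ∀ (j : J) (α₀ : ℝ) (U : CfgY (Matrix (Fin N) (Fin N) ℂ) (f j).toKIdx),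
      (bg9YC (Matrix (Fin N) (Fin N) ℂ) G P (f j)).Reg335 c35 α₀ U → (bg9KP (Matrix (Fin N) (Fin N) ℂ) G (f j).toKIdx).Reg335 c₀ α₀ U)
    {α₀' : ℝ} (hα' : 0 < α₀') (hαQ : α₀' ≤ alphaQ (d + 1) (ℓ + 1))
    (hKpl : ∀ (j : J) (a : ℝ), 0 ≤ a → a ≤ aInv → Kpl (f j).toKIdx a * (kGeo (f j).toKIdx).L ^ 4 < α₀') :
    ∀ j (α₀ : ℝ) (U : CfgY (Matrix (Fin N) (Fin N) ℂ) (f j).toKIdx) (δ : ℝ), MInv ≤ (geo9Y (f j)).M → 0 < α₀ → (geo9Y (f j)).M * α₀ ≤ aInv →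
      (bg9YC (Matrix (Fin N) (Fin N) ℂ) G P (f j)).Reg335 c35 α₀ U → 0 < δ → δ ≤ 1 →
      HasL2Majorant (g := toB6 (geo9Y (f j)) 0 True) (fun q : (Fin (d + 1) × SiteY (f j).toKIdx) × ι => blkC (f j).toKIdx (ιB j) q.1.2)
          (QbQC2 (f j).toKIdx (𝔮 j) b (.base U))
          (fun a a' => ((Real.sqrt (Fintype.card ι) * M₂ * ∑ j, ‖b j‖) *
            (1 * Real.sqrt (((N : ℝ) ^ 4 * ((1 + 2 * ((d : ℝ) + 1)) * (1 + kCol (d + 1) (ℓ + 1) * α₀' * (2 * ((d : ℝ) + 1))))) *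
              ((N : ℝ) ^ 4 * ((1 + 2 * ((d : ℝ) + 1)) * (1 + kCol (d + 1) (ℓ + 1) * α₀' * (2 * ((d : ℝ) + 1))))))) *
            Real.exp ((ℓ : ℝ) + 4)) * Real.exp (-(δ * (geo9Y (f j)).dist a a'))) ∧
        HasL2Majorant (g := toB6 (geo9Y (f j)) 0 True) (fun q : (Fin (d + 1) × SiteY (f j).toKIdx) × ι => blkC (f j).toKIdx (ιB j) q.1.2)
          (QsbQC2 (f j).toKIdx (𝔮s j) b (.base U))
          (fun a a' => ((Real.sqrt (Fintype.card ι) * M₂ * ∑ j, ‖b j‖) *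
            (1 * Real.sqrt (((N : ℝ) ^ 4 * ((1 + 2 * ((d : ℝ) + 1)) * (1 + kCol (d + 1) (ℓ + 1) * α₀' * (2 * ((d : ℝ) + 1))))) *
              ((N : ℝ) ^ 4 * ((1 + 2 * ((d : ℝ) + 1)) * (1 + kCol (d + 1) (ℓ + 1) * α₀' * (2 * ((d : ℝ) + 1))))))) *
            Real.exp ((ℓ : ℝ) + 4)) * Real.exp (-(δ * (geo9Y (f j)).dist a a'))) := by
  refine hQL2_of_kernels (Mstar := Mstar) b P f c35 G 𝔮 𝔮s ιB hM₂ hrepr MInv aInv (C := (N : ℝ) ^ 4 * ((1 + 2 * ((d : ℝ) + 1)) *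
    (1 + kCol (d + 1) (ℓ + 1) * α₀' * (2 * ((d : ℝ) + 1))))) (r := (ℓ : ℝ) + 4)
    (mul_nonneg (pow_nonneg (Nat.cast_nonneg _) 4) (mul_nonneg (by positivity)
      (add_nonneg zero_le_one (mul_nonneg (mul_nonneg (kCol_nonneg _ _) hα'.le) (by positivity))))) (by positivity)
    (fun j _ κ f' => qwt (f j).hN (f j).D (f j).hk κ f' + kCol (d + 1) (ℓ + 1) * α₀' * boxK (f j).toKIdx κ f')
    (fun j _ κ f' => (N : ℝ) ^ 4 * (qwt (f j).hN (f j).D (f j).hk κ f' + kCol (d + 1) (ℓ + 1) * α₀' * boxK (f j).toKIdx κ f'))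
    fun j α₀ U hM hα₀ hMa hU => ?_
  have hMx : 0 ≤ (geo9Y (f j)).M := hMInv.le.trans hM
  have hMα : 0 ≤ (kGeo (f j).toKIdx).M * α₀ := mul_nonneg hMx hα₀.le
  have hK : Kpl (f j).toKIdx ((kGeo (f j).toKIdx).M * α₀) * (kGeo (f j).toKIdx).L ^ 4 < α₀' := hKpl j _ hMα hMa
  obtain ⟨h1, h2, h3, h4, h5, h6, h7, h8, h9, h10⟩ :=
    knit_kernel_data_of_reg335P (f j).toKIdx (ιB j) hGU (hι j) hc hMα (hRP j α₀ U hU) hα' hαQ hK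
  refine ⟨h1, fun Λ κ => ?_, h3, h4, h5, h6, fun Ψ f' => ?_, h8, h9, h10⟩
  · rw [h𝔮 j U]; exact h2 Λ κ
  · rw [h𝔮s j U]; exact h7 Ψ f'

end Summit.QuantumFields.YangMills.BalabanUVNodes.N06SectBQLawsKnitMembers

end
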